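import Literature.NumberTheory.BostConnes.FiniteLevels
import Mathlib.Data.Nat.Totient
import HarnessLib

/-!
# The `p`-part of the integral BC-system: the Frobenius of `𝕎₀(𝔽̄_p) ≅ ℤ[μ^{(p)}]` at finite level

[ConnesConsani2011] ("On the arithmetic of the BC-system") encodes the `p`-primary structure of
the integral Bost–Connes system by the universal Witt ring `𝕎₀(𝔽̄_p)`: for an algebraically
closed field `k` the divisor of non-zero eigenvalues gives a ring isomorphism
`δ : 𝕎₀(k) ≅ ℤ[k^×]` under which "the Frobenius `F_n` on `𝕎₀(k)` is given on `ℤ[k^×]` by the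
natural linearization of the group endomorphism `k^× → k^×, g ↦ g^n`" (§2, Prop. 2.3); with an
isomorphism `σ : 𝔽̄_p^× ≅ μ^{(p)} ⊂ ℚ/ℤ` (fractions with denominator prime to `p`) this becomes
`σ̃ : 𝕎₀(𝔽̄_p) ≅ ℤ[μ^{(p)}] ⊂ ℤ[ℚ/ℤ]`, `F_n ↦ (γ ↦ nγ)` (Cor. 2.4), and the Frobenius `F_n` and
Verschiebung `V_n` are the restrictions of the BC operators `σ_n`, `ρ̃_n` (§4).

## Finite levels

`𝔽̄_p^× = ⋃_k 𝔽_{p^k}^×` with `𝔽_{p^k}^×` cyclic of order `p^k - 1`, so `ℤ[𝔽_{p^k}^×]` is the level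
`A_{p^k - 1} = R[ℤ/(p^k - 1)ℤ]` of the Bost–Connes endomotive
(`Literature.NumberTheory.BostConnes.sigmaMatrix`), on which the arithmetic Frobenius
`x ↦ x^p` acts as `σ_p` and its `m`-th power as `σ_{p^m}`; conversely every level `ℤ/nℤ` with
`n` prime to `p` occurs inside some `ℤ/(p^k - 1)ℤ` (`dvd_pow_totient_sub_one`: `n ∣ p^{φ(n)} - 1`),
which is the statement `μ^{(p)} = ⋃_k (p^k - 1)⁻¹ℤ/ℤ`.

This file records, fully proved, the exact Lefschetz numbers of the Frobenius powers on these
levels: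

* `card_fixedPoints_frobenius_pow`: `#{γ ∈ ℤ/(p^k - 1)ℤ : p^m γ = γ} = p^{gcd(k,m)} - 1`
  (`= |𝔽_{p^{gcd(k,m)}}^×|`, the fixed points of `x ↦ x^{p^m}` on `𝔽_{p^k}^×`);
* `trace_sigmaMatrix_frobenius_pow`: `Tr(σ_{p^m} | R[ℤ/(p^k - 1)ℤ]) = p^{gcd(k,m)} - 1`.

Both are the tree's `card_fixedPoints_mul_eq_gcd` / `trace_sigmaMatrix` (Ireland–Rosen
Prop. 3.3.1: `gcd(n, a - 1)` fixed points of `γ ↦ aγ`) combined with Mathlib's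
`Nat.pow_sub_one_gcd_pow_sub_one` (`gcd(p^k - 1, p^m - 1) = p^{gcd(k,m)} - 1`).

What is NOT here: the Witt ring `𝕎₀`, the isomorphisms `δ`, `σ̃`, the Verschiebung, the
`p`-adic completion / `𝕎(𝔽̄_p)` of §§5–6. No definitions and no named facts are introduced.

## Sources (read at the page)

* [ConnesConsani2011] A. Connes, C. Consani, *On the arithmetic of the BC-system*,
  arXiv:1103.4672 = J. Noncommut. Geom. 8 (2014) 873–945: §2 Prop. 2.3 and Cor. 2.4 (held text
  `paper:arxiv-1103.4672`, chunks p0006:L127–131, p0007:L19–24), §4 (p0009).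
* [IrelandRosen1990] K. Ireland, M. Rosen, *A Classical Introduction to Modern Number Theory*,
  2nd ed., Springer GTM 84 (1990), Ch. 3 §3 Prop. 3.3.1 (as used in `FiniteLevels`).
-/

namespace Literature.NumberTheory.BostConnes

/-- Every level `ℤ/nℤ` of the Bost–Connes endomotive with `n` prime to `p` lies inside a
Frobenius level `ℤ/(p^k - 1)ℤ ≅ 𝔽_{p^k}^×`: `n ∣ p^{φ(n)} - 1` (Euler), i.e.
`(1/n)ℤ/ℤ ⊂ (p^{φ(n)} - 1)⁻¹ℤ/ℤ` — the group `μ^{(p)}` of fractions with denominator prime to `p`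
is the union of the `(p^k - 1)⁻¹ℤ/ℤ = σ(𝔽_{p^k}^×)` ([ConnesConsani2011] Cor. 2.4:
`σ : 𝔽̄_p^× ≅ μ^{(p)}`). [cite: ConnesConsani2011, §2 Cor. 2.4] -/
theorem dvd_pow_totient_sub_one {p n : ℕ} (h : Nat.Coprime p n) : n ∣ p ^ n.totient - 1 := by
  rcases Nat.eq_zero_or_pos p with rfl | hp
  · rw [Nat.coprime_zero_left] at h
    rw [h]
    exact one_dvd _
  · exact (Nat.modEq_iff_dvd' (Nat.one_le_pow _ _ hp)).1 (Nat.ModEq.pow_totient h).symm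

/-- **Fixed points of the Frobenius powers on the finite levels of `𝕎₀(𝔽̄_p) ≅ ℤ[𝔽̄_p^×]`.**
On the level `𝔽_{p^k}^× ≅ ℤ/(p^k - 1)ℤ` the `m`-th power `F_p^m = F_{p^m}` of the Frobenius
(linearization of `g ↦ g^{p^m}`, i.e. `γ ↦ p^m γ` in additive notation, [ConnesConsani2011]
Prop. 2.3 / Cor. 2.4) has exactly `gcd(p^k - 1, p^m - 1) = p^{gcd(k,m)} - 1` fixed points
(`= |𝔽_{p^{gcd(k,m)}}^×`). [cite: ConnesConsani2011, §2 Prop. 2.3 and Cor. 2.4] -/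
theorem card_fixedPoints_frobenius_pow (p k m : ℕ) [NeZero (p ^ k - 1)] (hp : 0 < p) :
    (Finset.univ.filter fun j : ZMod (p ^ k - 1) =>
        ((p ^ m : ℕ) : ZMod (p ^ k - 1)) * j = j).card = p ^ Nat.gcd k m - 1 := by
  rw [card_fixedPoints_mul_eq_gcd (Nat.one_le_pow m p hp), Nat.pow_sub_one_gcd_pow_sub_one]

/-- **Lefschetz number of the Frobenius powers at finite level.** With `σ_a` the endomorphism
`e(γ) ↦ e(aγ)` of the level `R[ℤ/nℤ]` of the Bost–Connes endomotive
(`Literature.NumberTheory.BostConnes.sigmaMatrix`; by [ConnesConsani2011] §4 the Frobenius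
`F_a` of `𝕎₀(𝔽̄_p)` is the restriction of `σ_a`), on the Frobenius level `n = p^k - 1`
(`ℤ[𝔽_{p^k}^×]`): `Tr(σ_{p^m} | R[ℤ/(p^k - 1)ℤ]) = p^{gcd(k,m)} - 1` for every commutative ring `R`.
[cite: ConnesConsani2011, §2 Cor. 2.4 and §4] -/
theorem trace_sigmaMatrix_frobenius_pow (R : Type*) [CommRing R] (p k m : ℕ)
    [NeZero (p ^ k - 1)] (hp : 0 < p) :
    (sigmaMatrix R (p ^ k - 1) (p ^ m)).trace = ((p ^ Nat.gcd k m - 1 : ℕ) : R) := by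
  rw [trace_sigmaMatrix (Nat.one_le_pow m p hp), Nat.pow_sub_one_gcd_pow_sub_one]

end Literature.NumberTheory.BostConnes
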